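import Literature.NumberTheory.Sieve.BombieriFriedlanderIwaniecTheorem9Dyadic
import Literature.NumberTheory.Sieve.BombieriFriedlanderIwaniecErrorTerms
import HarnessLib

/-!
# Bombieri–Friedlander–Iwaniec 1986, §16 for Theorem 9: the trivially bounded parts, for pairs of moduli

Topic `Literature/NumberTheory/Sieve`, sibling of
`Literature.NumberTheory.Sieve.BombieriFriedlanderIwaniecTheorem9Proofs`; the pair-of-moduli
version of `Literature.NumberTheory.Sieve.BombieriFriedlanderIwaniecErrorTerms` (Theorem 10).
Everything here is PROVED (BFI Lemma 3 and Shiu's theorem enter as hypotheses, both theorems of the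
tree); no named fact is introduced.

For the moduli `d = qr`, `q ≤ Q`, `r ≤ R`, `QR < xℒ^{−B}` of Theorem 9 (BFI, Acta Math. 156 (1986),
§16 p. 250) the "trivial" estimates of §15 count, for each `n ∈ (x, 2x]`, the pairs `qr ∣ n − a`:
at most `τ(n − a)²` (`BFI.sum_sum_dvd_indicator_le`).

* `BFI.sum_sum_abs_sievedDisc_le_pairs` — the generic bound
  `∑_{r,q} ∑_i |sievedDisc (F i) (qr)| ≤ ∑_n G(n) τ(n−a)² + (∑_{r,q} 1/φ(qr)) ∑_n G(n)`;
* `BFI.tau_pow_moments_pairs_le` — `∑ τ(n)^k τ(n−a)² + Φ₂ ∑ τ(n)^k ≪ x (log x)^B` (Lemma 3 at modulus 1);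
* `BFI.sum_abs_sievedDisc_prodErr_pairs_le` — the error products (`log n₁` replaced by a constant on
  its box) contribute `≤ C Δ x (log x)^B`;
* `BFI.sum_abs_sievedDisc_prodMain_not_interior_pairs_le` — the non-interior main products live on
  two slivers of length `28Δx`; with `τ(n)^{14}τ(n−a)² ≤ (τ(n)^{28} + τ(n−a)⁴)/2` and Shiu's theorem at
  modulus `1` on the slivers and on their shifts by `a` they contribute `≤ C Δ x (log x)^B`
  (`x^{−1/5} ≤ Δ ≤ 1/112`; no restriction on the size of the moduli beyond `Q, R ≤ x`);
* `BFI.abstract_piece_sum_bound'` — the finite-sum skeleton of §15 over a general index set (pairs).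

## References

* E. Bombieri, J. B. Friedlander, H. Iwaniec, *Primes in arithmetic progressions to large moduli*,
  Acta Math. 156 (1986), 203–251: §1 Theorem 9 p. 209; §2 Lemma 3 p. 211; §14 pp. 244–246;
  §15 pp. 244–246; §16 p. 250. [BombieriFriedlanderIwaniecActa1986]
* P. Shiu, *A Brun–Titchmarsh theorem for multiplicative functions*, J. reine angew. Math. 313
  (1980), 161–170, Theorem 1. [Shiu1980]
-/

open Finset Real Filter
open scoped ArithmeticFunction.vonMangoldt ArithmeticFunction.sigma

namespace Literature.NumberTheory.Sieve

namespace BFI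


/-! ### Counting pairs of moduli: the generic bound -/

/-- For `n − a ≠ 0`, the pairs `(q, r)`, `q ≤ Qn`, `r ≤ Rn`, with `n ≡ a (mod qr)` number at most
`τ(|n − a|)²`. [folklore] -/
theorem sum_sum_congr_indicator_le {n : ℕ} {a : ℤ} (hna : (n : ℤ) - a ≠ 0) (Qn Rn : ℕ) :
    ∑ q ∈ Icc 1 Qn, ∑ r ∈ Icc 1 Rn,
        (if (n : ZMod (q * r)) = (a : ZMod (q * r)) then (1 : ℝ) else 0) ≤
      (σ 0 ((n : ℤ) - a).natAbs : ℝ) ^ 2 := by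
  calc ∑ q ∈ Icc 1 Qn, ∑ r ∈ Icc 1 Rn,
        (if (n : ZMod (q * r)) = (a : ZMod (q * r)) then (1 : ℝ) else 0)
      ≤ ∑ q ∈ Icc 1 Qn, ∑ r ∈ Icc 1 Rn,
          (if (((q * r : ℕ) : ℤ)) ∣ (n : ℤ) - a then (1 : ℝ) else 0) := by
        refine Finset.sum_le_sum fun q _ => Finset.sum_le_sum fun r _ => ?_
        by_cases hc : (n : ZMod (q * r)) = (a : ZMod (q * r))
        · rw [if_pos hc, if_pos ((natCast_eq_intCast_zmod_iff n (q * r) a).1 hc)]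
        · rw [if_neg hc]; split_ifs <;> norm_num
    _ ≤ _ := by
        have h := sum_sum_dvd_indicator_le Qn Rn ((n : ℤ) - a)
        rwa [if_neg hna] at h

/-- **Generic bound for sifted dyadic discrepancies summed over pairs of moduli** (with a pointwise
majorant `∑_i |F i n| ≤ G n` on `(x, 2x]`): for `x ≥ |a|`,
`∑_{r ≤ Rn} ∑_{q ≤ Qn} ∑_i |sievedDisc (F i) (qr) a z x|
  ≤ ∑_{x<n≤2x} G(n) τ(n − a)² + (∑_{r ≤ Rn} ∑_{q ≤ Qn} φ(qr)⁻¹) ∑_{x<n≤2x} G(n)`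
(drop the sieve conditions, interchange, and count the pairs `qr ∣ n − a`).  The pair version of
`BFI.sum_sum_abs_sievedDisc_le`, the mechanism of all "trivial" estimates of BFI §§15–16.
[folklore] -/
theorem sum_sum_abs_sievedDisc_le_pairs {ι : Type*} (s : Finset ι) (F : ι → ℕ → ℝ) {G : ℕ → ℝ}
    {a : ℤ} {x : ℝ} (hx : |(a : ℝ)| ≤ x)
    (hG : ∀ n ∈ Ioc ⌊x⌋₊ ⌊2 * x⌋₊, ∑ i ∈ s, |F i n| ≤ G n) (z : ℝ) (Qn Rn : ℕ) :
    ∑ r ∈ Icc 1 Rn, ∑ q ∈ Icc 1 Qn, ∑ i ∈ s, |sievedDisc (F i) (q * r) a z x| ≤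
      (∑ n ∈ Ioc ⌊x⌋₊ ⌊2 * x⌋₊, G n * (σ 0 ((n : ℤ) - a).natAbs : ℝ) ^ 2) +
        (∑ r ∈ Icc 1 Rn, ∑ q ∈ Icc 1 Qn, ((Nat.totient (q * r) : ℝ))⁻¹) *
          ∑ n ∈ Ioc ⌊x⌋₊ ⌊2 * x⌋₊, G n := by
  have hG0 : ∀ n ∈ Ioc ⌊x⌋₊ ⌊2 * x⌋₊, 0 ≤ G n := fun n hn =>
    (Finset.sum_nonneg fun i _ => abs_nonneg _).trans (hG n hn)
  -- per modulus (majorant, `if`-form)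
  have hd : ∀ d : ℕ, ∑ i ∈ s, |sievedDisc (F i) d a z x| ≤
      (∑ n ∈ Ioc ⌊x⌋₊ ⌊2 * x⌋₊, if (n : ZMod d) = (a : ZMod d) then G n else 0) +
        ((Nat.totient d : ℝ))⁻¹ * ∑ n ∈ Ioc ⌊x⌋₊ ⌊2 * x⌋₊, G n := by
    intro d
    have h := sum_abs_sievedDisc_le_of_majorant s F hG d a z
    rwa [Finset.sum_filter] at h
  calc ∑ r ∈ Icc 1 Rn, ∑ q ∈ Icc 1 Qn, ∑ i ∈ s, |sievedDisc (F i) (q * r) a z x|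
      ≤ ∑ r ∈ Icc 1 Rn, ∑ q ∈ Icc 1 Qn,
        ((∑ n ∈ Ioc ⌊x⌋₊ ⌊2 * x⌋₊, if (n : ZMod (q * r)) = (a : ZMod (q * r)) then G n else 0) +
          ((Nat.totient (q * r) : ℝ))⁻¹ * ∑ n ∈ Ioc ⌊x⌋₊ ⌊2 * x⌋₊, G n) :=
        Finset.sum_le_sum fun r _ => Finset.sum_le_sum fun q _ => hd (q * r)
    _ = (∑ r ∈ Icc 1 Rn, ∑ q ∈ Icc 1 Qn,
          ∑ n ∈ Ioc ⌊x⌋₊ ⌊2 * x⌋₊, if (n : ZMod (q * r)) = (a : ZMod (q * r)) then G n else 0) +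
        (∑ r ∈ Icc 1 Rn, ∑ q ∈ Icc 1 Qn, ((Nat.totient (q * r) : ℝ))⁻¹) *
          ∑ n ∈ Ioc ⌊x⌋₊ ⌊2 * x⌋₊, G n := by
        rw [Finset.sum_mul, ← Finset.sum_add_distrib]
        refine Finset.sum_congr rfl fun r _ => ?_
        rw [Finset.sum_mul, ← Finset.sum_add_distrib]
    _ ≤ _ := by
        refine add_le_add ?_ le_rfl
        -- interchange: `∑ r ∑ q ∑ n = ∑ n ∑ q ∑ r`, then count the pairs
        rw [Finset.sum_comm, Finset.sum_congr rfl fun q _ => Finset.sum_comm, Finset.sum_comm]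
        refine Finset.sum_le_sum fun n hn => ?_
        have hxn : x < n := Nat.lt_of_floor_lt (mem_Ioc.1 hn).1
        have hna : (n : ℤ) - a ≠ 0 := by
          have : (a : ℝ) < n := ((le_abs_self (a : ℝ)).trans hx).trans_lt hxn
          have : a < (n : ℤ) := by exact_mod_cast this
          omega
        calc ∑ q ∈ Icc 1 Qn, ∑ r ∈ Icc 1 Rn, (if (n : ZMod (q * r)) = (a : ZMod (q * r)) then G n else 0)
            = G n * ∑ q ∈ Icc 1 Qn, ∑ r ∈ Icc 1 Rn,
                (if (n : ZMod (q * r)) = (a : ZMod (q * r)) then (1 : ℝ) else 0) := by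
              rw [Finset.mul_sum]
              refine Finset.sum_congr rfl fun q _ => ?_
              rw [Finset.mul_sum]
              exact Finset.sum_congr rfl fun r _ => by split_ifs <;> simp
          _ ≤ G n * (σ 0 ((n : ℤ) - a).natAbs : ℝ) ^ 2 :=
              mul_le_mul_of_nonneg_left (sum_sum_congr_indicator_le hna Qn Rn) (hG0 n hn)

/-! ### Divisor moments against the pair count -/

/-- For `n > |a|`: `(n − a).natAbs = (n − a).toNat ≥ 1`. [folklore] -/
theorem natAbs_sub_eq_toNat {a : ℤ} {n : ℕ} (h : |a| < (n : ℤ)) :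
    ((n : ℤ) - a).natAbs = ((n : ℤ) - a).toNat := by
  have h1 : (0 : ℤ) ≤ (n : ℤ) - a := by
    have := (abs_lt.1 h).2; omega
  omega

/-- **The divisor-moment bound behind the trivial estimates for pairs of moduli** (BFI Lemma 3 at
modulus `1` and the elementary moments of `τ`): for `a ≠ 0` and `k ≥ 2` there are `B, C ≥ 0`, `x₀`
such that for `x ≥ x₀` and `Qn, Rn ≤ x`,
`∑_{x<n≤2x} τ(n)^k τ(n−a)² + (∑_{r≤Rn} ∑_{q≤Qn} 1/φ(qr)) ∑_{x<n≤2x} τ(n)^k ≤ C x (log x)^B`.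
[cite: BombieriFriedlanderIwaniecActa1986, §2 Lemma 3 p. 211] -/
theorem tau_pow_moments_pairs_le (hL3 : BombieriFriedlanderIwaniecLemma3) {a : ℤ} (ha : a ≠ 0)
    {k : ℕ} (hk : 2 ≤ k) :
    ∃ B C x₀ : ℝ, 0 ≤ B ∧ 0 ≤ C ∧ ∀ x : ℝ, x₀ ≤ x → ∀ Qn Rn : ℕ, (Qn : ℝ) ≤ x → (Rn : ℝ) ≤ x →
      (∑ n ∈ Ioc ⌊x⌋₊ ⌊2 * x⌋₊, (σ 0 n : ℝ) ^ k * (σ 0 ((n : ℤ) - a).natAbs : ℝ) ^ 2) +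
        (∑ r ∈ Icc 1 Rn, ∑ q ∈ Icc 1 Qn, ((Nat.totient (q * r) : ℝ))⁻¹) *
          ∑ n ∈ Ioc ⌊x⌋₊ ⌊2 * x⌋₊, (σ 0 n : ℝ) ^ k ≤
      C * x * Real.log x ^ B := by
  have hk0 : 0 < k := by omega
  obtain ⟨B, C, x₁, hL⟩ := hL3 a ha ((k : ℕ) : ℝ) (by exact_mod_cast hk0) (1 / 2) (by norm_num)
  obtain ⟨C₁, hC₁, h₁⟩ := exists_sum_sigma_zero_pow_le_real k
  -- keep the large numeral `E` opaque
  obtain ⟨E, hE⟩ : ∃ E : ℕ, E = 2 ^ (k + 1) := ⟨_, rfl⟩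
  rw [← hE] at h₁
  set B' : ℝ := max B 0 with hB'
  refine ⟨B' + ((E + 4 : ℕ) : ℝ), 2 * |C| * 2 ^ B' + 32 * C₁ * 2 ^ E, max x₁ (max (|(a : ℝ)|) 4),
    by positivity, by positivity, fun x hx Qn Rn hQn hRn => ?_⟩
  have hx₁ : x₁ ≤ x := le_trans (le_max_left _ _) hx
  have hxa : |(a : ℝ)| ≤ x := le_trans ((le_max_left _ _).trans (le_max_right _ _)) hx
  have hx4 : (4 : ℝ) ≤ x := le_trans ((le_max_right _ _).trans (le_max_right _ _)) hx
  have hx0 : 0 < x := by linarith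
  have hL1 : 1 ≤ Real.log x := by
    rw [Real.le_log_iff_exp_le hx0]
    exact le_trans (by have := Real.exp_one_lt_d9; norm_num at this ⊢; linarith) hx4
  have hL0 : 0 < Real.log x := by linarith
  have hlog2x : Real.log (2 * x) ≤ 2 * Real.log x := by
    rw [Real.log_mul (by norm_num) hx0.ne']
    have : Real.log 2 ≤ Real.log x := Real.log_le_log (by norm_num) (by linarith)
    linarith
  have hlog2x1 : 1 ≤ Real.log (2 * x) := hL1.trans (Real.log_le_log hx0 (by linarith))
  -- (1) Lemma 3 at `k = 1`
  have hA : ∑ n ∈ Ioc ⌊x⌋₊ ⌊2 * x⌋₊, (σ 0 n : ℝ) ^ k * (σ 0 ((n : ℤ) - a).natAbs : ℝ) ^ 2 ≤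
      |C| * (2 * x) * (2 * Real.log x) ^ B' := by
    have h := hL (2 * x) (by linarith) 1 le_rfl
      (by rw [Nat.cast_one]; exact Real.one_le_rpow (by linarith) (by norm_num)) (0 : ZMod 1)
    have hσ1 : ((σ 0 1 : ℕ) : ℝ) = 1 := by simp
    simp only [Real.rpow_natCast, Nat.cast_one, div_one, hσ1, one_mul] at h
    calc ∑ n ∈ Ioc ⌊x⌋₊ ⌊2 * x⌋₊, (σ 0 n : ℝ) ^ k * (σ 0 ((n : ℤ) - a).natAbs : ℝ) ^ 2
        ≤ ∑ n ∈ Ioc ⌊x⌋₊ ⌊2 * x⌋₊,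
            (σ 0 n : ℝ) ^ k * (σ 0 ((n : ℤ) - a).toNat : ℝ) ^ k := by
          refine Finset.sum_le_sum fun n hn => ?_
          rw [Finset.mem_Ioc] at hn
          have hxn : x < n := Nat.lt_of_floor_lt hn.1
          have han : |a| < (n : ℤ) := by
            have : |(a : ℝ)| < n := hxa.trans_lt hxn
            rw [← Int.cast_abs] at this
            exact_mod_cast this
          rw [natAbs_sub_eq_toNat han]
          have h1 : (1 : ℝ) ≤ (σ 0 ((n : ℤ) - a).toNat : ℝ) := by
            have := BombieriFriedlanderIwaniecLemma3.one_le_toNat_sub han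
            exact_mod_cast one_le_sigma_zero (by omega)
          refine mul_le_mul_of_nonneg_left ?_ (by positivity)
          exact pow_le_pow_right₀ h1 hk
      _ ≤ ∑ m ∈ (Icc 1 ⌊2 * x⌋₊).filter (fun m : ℕ => |a| < (m : ℤ) ∧ (m : ZMod 1) = 0),
            (σ 0 m : ℝ) ^ k * (σ 0 ((m : ℤ) - a).toNat : ℝ) ^ k := by
          refine Finset.sum_le_sum_of_subset_of_nonneg (fun n hn => ?_) fun _ _ _ => by positivity
          rw [Finset.mem_Ioc] at hn
          rw [Finset.mem_filter, Finset.mem_Icc]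
          have hxn : x < n := Nat.lt_of_floor_lt hn.1
          have han : |a| < (n : ℤ) := by
            have : |(a : ℝ)| < n := hxa.trans_lt hxn
            rw [← Int.cast_abs] at this
            exact_mod_cast this
          exact ⟨⟨by omega, hn.2⟩, han, Subsingleton.elim _ _⟩
      _ ≤ C * (2 * x) * Real.log (2 * x) ^ B := by
          convert h using 2
      _ ≤ |C| * (2 * x) * (2 * Real.log x) ^ B' := by
          have h3 : Real.log (2 * x) ^ B ≤ (2 * Real.log x) ^ B' :=
            (Real.rpow_le_rpow_of_exponent_le hlog2x1 (le_max_left _ _)).trans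
              (Real.rpow_le_rpow (by linarith) hlog2x (le_max_right _ _))
          calc C * (2 * x) * Real.log (2 * x) ^ B ≤ |C| * (2 * x) * Real.log (2 * x) ^ B :=
                mul_le_mul_of_nonneg_right (mul_le_mul_of_nonneg_right (le_abs_self C) (by linarith))
                  (Real.rpow_nonneg (by linarith) _)
            _ ≤ |C| * (2 * x) * (2 * Real.log x) ^ B' :=
                mul_le_mul_of_nonneg_left h3 (by positivity)
  -- (2) the plain moment and the totient sum
  have hB2 : ∑ n ∈ Ioc ⌊x⌋₊ ⌊2 * x⌋₊, (σ 0 n : ℝ) ^ k ≤ C₁ * (2 * x) * (2 * Real.log x) ^ (E) := by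
    calc ∑ n ∈ Ioc ⌊x⌋₊ ⌊2 * x⌋₊, (σ 0 n : ℝ) ^ k ≤ ∑ n ∈ Icc 1 ⌊2 * x⌋₊, (σ 0 n : ℝ) ^ k :=
          Finset.sum_le_sum_of_subset_of_nonneg (fun n hn => by
            rw [Finset.mem_Ioc] at hn; rw [Finset.mem_Icc]; omega) fun _ _ _ => by positivity
      _ ≤ C₁ * (2 * x) * Real.log (2 * x) ^ (E) := h₁ (2 * x) (by linarith)
      _ ≤ C₁ * (2 * x) * (2 * Real.log x) ^ (E) := by
          refine mul_le_mul_of_nonneg_left ?_ (by positivity)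
          exact pow_le_pow_left₀ (by linarith) hlog2x _
  have hΦ : ∑ r ∈ Icc 1 Rn, ∑ q ∈ Icc 1 Qn, ((Nat.totient (q * r) : ℝ))⁻¹ ≤ 16 * Real.log x ^ 4 := by
    refine (sum_sum_totient_mul_inv_le Qn Rn).trans ?_
    have hlogQ : Real.log Qn ≤ Real.log x := by
      rcases Nat.eq_zero_or_pos Qn with h0 | hpos
      · rw [h0]; simp [hL0.le]
      · exact Real.log_le_log (by exact_mod_cast hpos) hQn
    have hlogR : Real.log Rn ≤ Real.log x := by
      rcases Nat.eq_zero_or_pos Rn with h0 | hpos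
      · rw [h0]; simp [hL0.le]
      · exact Real.log_le_log (by exact_mod_cast hpos) hRn
    have hlogQ0 : 0 ≤ Real.log Qn := Real.log_natCast_nonneg _
    have hlogR0 : 0 ≤ Real.log Rn := Real.log_natCast_nonneg _
    have h1 : (1 + Real.log Qn) ^ 2 ≤ 4 * Real.log x ^ 2 := by nlinarith
    have h2 : (1 + Real.log Rn) ^ 2 ≤ 4 * Real.log x ^ 2 := by nlinarith
    calc _ ≤ (4 * Real.log x ^ 2) * (4 * Real.log x ^ 2) := mul_le_mul h1 h2 (by positivity) (by positivity)
      _ = 16 * Real.log x ^ 4 := by ring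
  have hΦ0 : 0 ≤ ∑ r ∈ Icc 1 Rn, ∑ q ∈ Icc 1 Qn, ((Nat.totient (q * r) : ℝ))⁻¹ :=
    Finset.sum_nonneg fun _ _ => Finset.sum_nonneg fun _ _ => inv_nonneg.2 (Nat.cast_nonneg _)
  -- (3) assemble
  have hpow1 : (2 * Real.log x) ^ B' = 2 ^ B' * Real.log x ^ B' := Real.mul_rpow (by norm_num) hL0.le
  have hLB : Real.log x ^ B' ≤ Real.log x ^ (B' + ((E + 4 : ℕ) : ℝ)) :=
    Real.rpow_le_rpow_of_exponent_le hL1 (le_add_of_nonneg_right (by positivity))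
  have hL2 : Real.log x ^ 4 * Real.log x ^ (E) ≤ Real.log x ^ (B' + ((E + 4 : ℕ) : ℝ)) := by
    rw [← pow_add, ← Real.rpow_natCast]
    refine Real.rpow_le_rpow_of_exponent_le hL1 ?_
    have : (0 : ℝ) ≤ B' := le_max_right _ _
    push_cast
    linarith
  calc _ ≤ |C| * (2 * x) * (2 * Real.log x) ^ B' +
        (16 * Real.log x ^ 4) * (C₁ * (2 * x) * (2 * Real.log x) ^ (E)) :=
        add_le_add hA (mul_le_mul hΦ hB2 (Finset.sum_nonneg fun _ _ => by positivity) (by positivity))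
    _ = (2 * |C| * 2 ^ B') * x * Real.log x ^ B' +
        (32 * C₁ * 2 ^ (E)) * x * (Real.log x ^ 4 * Real.log x ^ (E)) := by
        rw [hpow1, mul_pow]; ring
    _ ≤ (2 * |C| * 2 ^ B') * x * Real.log x ^ (B' + ((E + 4 : ℕ) : ℝ)) +
        (32 * C₁ * 2 ^ (E)) * x * Real.log x ^ (B' + ((E + 4 : ℕ) : ℝ)) :=
        add_le_add (mul_le_mul_of_nonneg_left hLB (by positivity))
          (mul_le_mul_of_nonneg_left hL2 (by positivity))
    _ = _ := by ring

/-! ### The error products, summed over pairs of moduli -/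

/-- **The error products are negligible, for pairs of moduli** (BFI §15, p. 245–246, as used in
§16: replacing `log n₁` by a constant on each box costs a factor `Δ = ℒ^{−A₁}`): for `a ≠ 0` there
are `B, C ≥ 0`, `x₀` such that for `x ≥ x₀`, `1 ≤ j ≤ 7`, `0 < Δ ≤ 1`, all `z, U, K` and
`Qn, Rn ≤ x`,
`∑_{r ≤ Rn} ∑_{q ≤ Qn} ∑_κ |sievedDisc (PErr κ) (qr) a z x| ≤ C Δ x (log x)^B`.
[cite: BombieriFriedlanderIwaniecActa1986, §15 p. 245–246; §16 p. 250] -/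
theorem sum_abs_sievedDisc_prodErr_pairs_le (hL3 : BombieriFriedlanderIwaniecLemma3) {a : ℤ}
    (ha : a ≠ 0) :
    ∃ B C x₀ : ℝ, 0 ≤ B ∧ 0 ≤ C ∧ ∀ x : ℝ, x₀ ≤ x → ∀ (z Δ : ℝ) (U j K Qn Rn : ℕ),
      1 ≤ j → j ≤ 7 → 0 < Δ → Δ ≤ 1 → (Qn : ℝ) ≤ x → (Rn : ℝ) ≤ x →
      ∑ r ∈ Icc 1 Rn, ∑ q ∈ Icc 1 Qn,
          ∑ κ ∈ tuples j K, |sievedDisc (fun n => prodErr x z Δ U j κ n) (q * r) a z x| ≤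
        C * Δ * x * Real.log x ^ B := by
  obtain ⟨B, C, x₀, hB, hC, h⟩ := tau_pow_moments_pairs_le hL3 ha (k := 14) (by norm_num)
  refine ⟨B, C, max x₀ (max (|(a : ℝ)|) 1), hB, hC,
    fun x hx z Δ U j K Qn Rn hj _ hΔ hΔ1 hQn hRn => ?_⟩
  have hx₀ : x₀ ≤ x := le_trans (le_max_left _ _) hx
  have hxa : |(a : ℝ)| ≤ x := le_trans ((le_max_left _ _).trans (le_max_right _ _)) hx
  have hx1 : (1 : ℝ) ≤ x := le_trans ((le_max_right _ _).trans (le_max_right _ _)) hx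
  have hx0 : 0 < x := by linarith
  have hG : ∀ n ∈ Ioc ⌊x⌋₊ ⌊2 * x⌋₊,
      ∑ κ ∈ tuples j K, |prodErr x z Δ U j κ n| ≤ Δ * (σ 0 n : ℝ) ^ 14 := by
    intro n hn
    rw [Finset.mem_Ioc] at hn
    refine (sum_abs_prodErr_le hj hx0 hΔ hΔ1 n).trans (mul_le_mul_of_nonneg_left ?_ hΔ.le)
    have h1 : (1 : ℝ) ≤ (σ 0 n : ℝ) := by exact_mod_cast one_le_sigma_zero (by omega)
    exact pow_le_pow_right₀ h1 (by omega)
  refine (sum_sum_abs_sievedDisc_le_pairs (tuples j K) (fun κ n => prodErr x z Δ U j κ n) hxa hG z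
    Qn Rn).trans ?_
  have key := h x hx₀ Qn Rn hQn hRn
  have e1 : ∑ n ∈ Ioc ⌊x⌋₊ ⌊2 * x⌋₊, Δ * (σ 0 n : ℝ) ^ 14 * (σ 0 ((n : ℤ) - a).natAbs : ℝ) ^ 2 =
      Δ * ∑ n ∈ Ioc ⌊x⌋₊ ⌊2 * x⌋₊, (σ 0 n : ℝ) ^ 14 * (σ 0 ((n : ℤ) - a).natAbs : ℝ) ^ 2 := by
    rw [Finset.mul_sum]
    exact Finset.sum_congr rfl fun n _ => by ring
  have e2 : ∑ n ∈ Ioc ⌊x⌋₊ ⌊2 * x⌋₊, Δ * (σ 0 n : ℝ) ^ 14 = Δ * ∑ n ∈ Ioc ⌊x⌋₊ ⌊2 * x⌋₊, (σ 0 n : ℝ) ^ 14 := by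
    rw [Finset.mul_sum]
  rw [e1, e2]
  calc Δ * (∑ n ∈ Ioc ⌊x⌋₊ ⌊2 * x⌋₊, (σ 0 n : ℝ) ^ 14 * (σ 0 ((n : ℤ) - a).natAbs : ℝ) ^ 2) +
        (∑ r ∈ Icc 1 Rn, ∑ q ∈ Icc 1 Qn, ((Nat.totient (q * r) : ℝ))⁻¹) *
          (Δ * ∑ n ∈ Ioc ⌊x⌋₊ ⌊2 * x⌋₊, (σ 0 n : ℝ) ^ 14)
      = Δ * ((∑ n ∈ Ioc ⌊x⌋₊ ⌊2 * x⌋₊, (σ 0 n : ℝ) ^ 14 * (σ 0 ((n : ℤ) - a).natAbs : ℝ) ^ 2) +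
        (∑ r ∈ Icc 1 Rn, ∑ q ∈ Icc 1 Qn, ((Nat.totient (q * r) : ℝ))⁻¹) *
          ∑ n ∈ Ioc ⌊x⌋₊ ⌊2 * x⌋₊, (σ 0 n : ℝ) ^ 14) := by ring
    _ ≤ Δ * (C * x * Real.log x ^ B) := mul_le_mul_of_nonneg_left key hΔ.le
    _ = C * Δ * x * Real.log x ^ B := by ring


/-! ### The non-interior main products, summed over pairs of moduli -/

/-- Shiu's theorem for `τ^r` on a short interval, modulus `1`: there are `C ≥ 0`, `x₀` with
`∑_{X < n ≤ X + y} τ(n)^r ≤ C y (log X)^{2^r − 1}` for `X ≥ x₀`, `X^{1/4} ≤ y ≤ X`.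
[cite: Shiu1980, Theorem 1] -/
theorem shiu_sigma_zero_pow_interval (hS : Shiu1980BrunTitchmarsh) (r : ℕ) :
    ∃ C x₀ : ℝ, 0 ≤ C ∧ ∀ X y : ℝ, x₀ ≤ X → X ^ (1 / 4 : ℝ) ≤ y → y ≤ X →
      ∑ n ∈ (Icc 1 ⌊X + y⌋₊).filter (fun n : ℕ => X < n), (σ 0 n : ℝ) ^ r ≤
        C * y * Real.log X ^ (2 ^ r - 1) := by
  obtain ⟨C, x₀, hC, h⟩ := hS.sigma_zero_pow r (ε := 1 / 4) (θ := 1 / 4)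
    (by norm_num) (by norm_num) (by norm_num) (by norm_num)
  refine ⟨C, max x₀ 16, hC, fun X y hX hy1 hy2 => ?_⟩
  have hx₀ : x₀ ≤ X := le_trans (le_max_left _ _) hX
  have hX16 : (16 : ℝ) ≤ X := le_trans (le_max_right _ _) hX
  have hy2' : (2 : ℝ) ≤ y := by
    refine le_trans ?_ hy1
    calc (2 : ℝ) = (16 : ℝ) ^ (1 / 4 : ℝ) := by
          rw [show (16 : ℝ) = 2 ^ (4 : ℝ) by norm_num, ← Real.rpow_mul (by norm_num)]; norm_num
      _ ≤ X ^ (1 / 4 : ℝ) := Real.rpow_le_rpow (by norm_num) hX16 (by norm_num)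
  have hq : ((1 : ℕ) : ℝ) < y ^ (1 - 1 / 4 : ℝ) := by
    rw [Nat.cast_one]
    exact Real.one_lt_rpow (by linarith) (by norm_num)
  have h1 := h X y hx₀ hy1 hy2 1 le_rfl hq 0 (Nat.coprime_one_right 0)
  have hfil : (Icc 1 ⌊X + y⌋₊).filter (fun n : ℕ => X < n ∧ (n : ZMod 1) = ((0 : ℕ) : ZMod 1)) =
      (Icc 1 ⌊X + y⌋₊).filter (fun n : ℕ => X < n) :=
    Finset.filter_congr fun n _ => ⟨fun h => h.1, fun h => ⟨h, Subsingleton.elim _ _⟩⟩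
  rw [hfil, Nat.totient_one, Nat.cast_one, div_one] at h1
  exact h1

/-- Re-indexing a shifted divisor sum over a short interval: for `X ≥ |a|` and `f ≥ 0`,
`∑_{X < n ≤ X + y} f(|n − a|) ≤ ∑_{X − a < m ≤ X − a + y} f(m)` (`m = n − a`). [folklore] -/
theorem sum_filter_shift_le {a : ℤ} {X y : ℝ} (hX : |(a : ℝ)| ≤ X) (f : ℕ → ℝ) (hf : ∀ m, 0 ≤ f m) :
    ∑ n ∈ (Icc 1 ⌊X + y⌋₊).filter (fun n : ℕ => X < n), f ((n : ℤ) - a).natAbs ≤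
      ∑ m ∈ (Icc 1 ⌊(X - a) + y⌋₊).filter (fun m : ℕ => X - a < m), f m := by
  set S := (Icc 1 ⌊X + y⌋₊).filter (fun n : ℕ => X < n) with hS
  set e : ℕ → ℕ := fun n => ((n : ℤ) - a).natAbs with he
  have hpos : ∀ n ∈ S, 0 < (n : ℤ) - a := by
    intro n hn
    have hXn : X < n := (Finset.mem_filter.1 hn).2
    have : (a : ℝ) < n := ((le_abs_self (a : ℝ)).trans hX).trans_lt hXn
    have : a < (n : ℤ) := by exact_mod_cast this
    omega
  have hinj : ∀ n₁ ∈ S, ∀ n₂ ∈ S, e n₁ = e n₂ → n₁ = n₂ := by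
    intro n₁ h₁ n₂ h₂ h12
    have h1 := hpos n₁ h₁
    have h2 := hpos n₂ h₂
    simp only [he] at h12
    omega
  rw [← Finset.sum_image hinj]
  refine Finset.sum_le_sum_of_subset_of_nonneg (fun m hm => ?_) fun _ _ _ => hf _
  rw [Finset.mem_image] at hm
  obtain ⟨n, hn, rfl⟩ := hm
  have hn' := Finset.mem_filter.1 hn
  have hXn : X < n := hn'.2
  have hnXy : (n : ℝ) ≤ X + y := by
    have := (Finset.mem_Icc.1 hn'.1).2
    have h0 : 0 ≤ X + y := by
      by_contra hneg
      push Not at hneg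
      have : ⌊X + y⌋₊ = 0 := Nat.floor_eq_zero.2 (by linarith)
      have h1 := (Finset.mem_Icc.1 hn'.1).1
      omega
    exact (Nat.cast_le.2 this).trans (Nat.floor_le h0)
  have hp := hpos n hn
  have hcast : (((n : ℤ) - a).natAbs : ℝ) = (n : ℝ) - a := by
    have h1 : (((n : ℤ) - a).natAbs : ℝ) = |((n : ℝ) - a)| := by
      rw [Nat.cast_natAbs]; push_cast; rfl
    have h2 : (0 : ℝ) < (n : ℝ) - a := by exact_mod_cast hp
    rw [h1, abs_of_pos h2]
  rw [Finset.mem_filter, Finset.mem_Icc]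
  refine ⟨⟨Int.natAbs_pos.2 hp.ne' , Nat.le_floor ?_⟩, ?_⟩
  · rw [hcast]; linarith
  · rw [hcast]; linarith

/-- `uv ≤ (u² + v²)/2` in the form `t^{14} s² ≤ (t^{28} + s⁴)/2`. [folklore] -/
theorem pow14_mul_sq_le (t s : ℝ) : t ^ 14 * s ^ 2 ≤ (t ^ 28 + s ^ 4) / 2 := by
  nlinarith [sq_nonneg (t ^ 14 - s ^ 2)]

set_option maxHeartbeats 1600000 in -- Shiu on four slivers with ~70 hypotheses
/-- **The non-interior main products are negligible, for pairs of moduli** (BFI §15, p. 245–246, as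
used in §16: the tuples of boxes not inside `(x, 2x]` only meet the two slivers of relative length
`O(Δ)` at the ends).  For pairs `qr` of moduli up to `x` (beyond the range `q < y^{3/4}` of Shiu's
theorem in progressions) the count of the pairs `qr ∣ n − a` is `τ(n − a)²`, separated from
`τ(n)^{14}` by `uv ≤ (u² + v²)/2`, and Shiu's theorem is applied with modulus `1` to `τ^{28}` on the
slivers and to `τ⁴` on their shifts by `a`.  There are `B, C ≥ 0`, `x₀` such that for `x ≥ x₀`,
`1 ≤ j ≤ 7`, `x^{−1/5} ≤ Δ ≤ 1/112`, all `z, U, K` and `Qn, Rn ≤ x`,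
`∑_{r ≤ Rn} ∑_{q ≤ Qn} ∑_{κ not interior} |sievedDisc (PMain κ) (qr) a z x| ≤ C Δ x (log x)^B`.
[cite: BombieriFriedlanderIwaniecActa1986, §15 p. 245–246; §16 p. 250] -/
theorem sum_abs_sievedDisc_prodMain_not_interior_pairs_le (hS : Shiu1980BrunTitchmarsh) (a : ℤ) :
    ∃ B C x₀ : ℝ, 0 ≤ B ∧ 0 ≤ C ∧ ∀ x : ℝ, x₀ ≤ x → ∀ (z Δ : ℝ) (U j K Qn Rn : ℕ),
      1 ≤ j → j ≤ 7 → x ^ (-(1 / 5 : ℝ)) ≤ Δ → 112 * Δ ≤ 1 → (Qn : ℝ) ≤ x → (Rn : ℝ) ≤ x →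
      ∑ r ∈ Icc 1 Rn, ∑ q ∈ Icc 1 Qn,
          ∑ κ ∈ (tuples j K).filter (fun κ => ¬ Interior x Δ j κ),
            |sievedDisc (fun n => prodMain x z Δ U j κ n) (q * r) a z x| ≤
        C * Δ * x * Real.log x ^ B := by
  obtain ⟨C14, x14, hC14, h14⟩ := shiu_sigma_zero_pow_interval hS 14
  obtain ⟨C28, x28, hC28, h28⟩ := shiu_sigma_zero_pow_interval hS 28
  obtain ⟨C4, x4, hC4, h4⟩ := shiu_sigma_zero_pow_interval hS 4
  -- keep the large numeral opaque
  obtain ⟨E, hE⟩ : ∃ E : ℕ, E = 2 ^ 28 - 1 := ⟨_, rfl⟩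
  have hE14 : 2 ^ 14 - 1 ≤ E := by rw [hE]; norm_num
  have hE4 : 2 ^ 4 - 1 ≤ E := by rw [hE]; norm_num
  have hE28 : 2 ^ 28 - 1 ≤ E := by rw [hE]
  refine ⟨((E + 4 : ℕ) : ℝ), 28 * 2 ^ E * (C28 + C4 + 32 * C14),
    max (2 * max x14 (max x28 x4) + 2 * |(a : ℝ)| + 16) (8 * |(a : ℝ)| + 16), by positivity,
    by positivity, fun x hx z Δ U j K Qn Rn hj hj7 hΔ hΔ1 hQn hRn => ?_⟩
  have hxA : 2 * max x14 (max x28 x4) + 2 * |(a : ℝ)| + 16 ≤ x := le_trans (le_max_left _ _) hx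
  have hxa8 : 8 * |(a : ℝ)| + 16 ≤ x := le_trans (le_max_right _ _) hx
  have ha0 : 0 ≤ |(a : ℝ)| := abs_nonneg _
  have hx16 : (16 : ℝ) ≤ x := by linarith
  have hx0 : 0 < x := by linarith
  have hx1 : (1 : ℝ) ≤ x := by linarith
  have hxa : |(a : ℝ)| ≤ x := by linarith
  have hL1 : 1 ≤ Real.log x := by
    rw [Real.le_log_iff_exp_le hx0]
    exact le_trans (by have := Real.exp_one_lt_d9; norm_num at this ⊢; linarith) hx16
  have hL0 : 0 < Real.log x := by linarith
  have hΔ0 : 0 < Δ := lt_of_lt_of_le (Real.rpow_pos_of_pos hx0 _) hΔ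
  -- the sliver length
  set y : ℝ := 28 * Δ * x with hy
  have hyx4 : y ≤ x / 4 := by rw [hy]; nlinarith
  have hy0 : 0 < y := by positivity
  have hy45 : x ^ (4 / 5 : ℝ) ≤ y := by
    have : x ^ (-(1 / 5 : ℝ)) * x ≤ Δ * x := mul_le_mul_of_nonneg_right hΔ hx0.le
    rw [← Real.rpow_add_one hx0.ne'] at this
    norm_num at this
    rw [hy]; nlinarith
  have hlog2x : Real.log (2 * x) ≤ 2 * Real.log x := by
    rw [Real.log_mul (by norm_num) hx0.ne']
    have : Real.log 2 ≤ Real.log x := Real.log_le_log (by norm_num) (by linarith)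
    linarith
  have hlog3x : Real.log (3 * x) ≤ 2 * Real.log x := by
    have h1 : 3 * x ≤ x ^ 2 := by nlinarith
    calc Real.log (3 * x) ≤ Real.log (x ^ 2) := Real.log_le_log (by linarith) h1
      _ = 2 * Real.log x := by rw [Real.log_pow]; norm_num
  -- Shiu applies on `(X', X' + y]` whenever `x/2 − |a| ≤ X' ≤ 3x`
  have hwin : ∀ X' : ℝ, x / 2 - |(a : ℝ)| ≤ X' → X' ≤ 3 * x →
      max x14 (max x28 x4) ≤ X' ∧ X' ^ (1 / 4 : ℝ) ≤ y ∧ y ≤ X' ∧ 0 ≤ Real.log X' ∧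
        Real.log X' ≤ 2 * Real.log x := by
    intro X' h1 h2
    have hX'4 : x / 4 ≤ X' := by linarith
    have hX'0 : 0 < X' := by linarith
    refine ⟨by linarith, ?_, hyx4.trans hX'4, Real.log_nonneg (by linarith), ?_⟩
    · calc X' ^ (1 / 4 : ℝ) ≤ (3 * x) ^ (1 / 4 : ℝ) := Real.rpow_le_rpow hX'0.le h2 (by norm_num)
        _ ≤ (x ^ (2 : ℝ)) ^ (1 / 4 : ℝ) := by
            refine Real.rpow_le_rpow (by linarith) ?_ (by norm_num)
            rw [Real.rpow_two]; nlinarith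
        _ = x ^ (1 / 2 : ℝ) := by rw [← Real.rpow_mul hx0.le]; norm_num
        _ ≤ x ^ (4 / 5 : ℝ) := Real.rpow_le_rpow_of_exponent_le hx1 (by norm_num)
        _ ≤ y := hy45
    · exact (Real.log_le_log hX'0 h2).trans hlog3x
  -- Shiu bounds on a window, all log-powers raised to `(2 log x)^E`
  have hpowE : ∀ (X' : ℝ) (k : ℕ), k ≤ E → 0 ≤ Real.log X' → Real.log X' ≤ 2 * Real.log x →
      Real.log X' ^ k ≤ (2 * Real.log x) ^ E := by
    intro X' k hk h0 h2
    calc Real.log X' ^ k ≤ (2 * Real.log x) ^ k := pow_le_pow_left₀ h0 h2 k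
      _ ≤ (2 * Real.log x) ^ E := pow_le_pow_right₀ (by linarith) hk
  have hS14 : ∀ X' : ℝ, x / 2 - |(a : ℝ)| ≤ X' → X' ≤ 3 * x →
      ∑ n ∈ (Icc 1 ⌊X' + y⌋₊).filter (fun n : ℕ => X' < n), (σ 0 n : ℝ) ^ 14 ≤
        C14 * y * (2 * Real.log x) ^ E := by
    intro X' h1 h2
    obtain ⟨hx₀, hy1, hy2, hl0, hl2⟩ := hwin X' h1 h2
    refine (h14 X' y ((le_max_left _ _).trans hx₀) hy1 hy2).trans ?_
    exact mul_le_mul_of_nonneg_left (hpowE X' _ hE14 hl0 hl2) (by positivity)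
  have hS28 : ∀ X' : ℝ, x / 2 - |(a : ℝ)| ≤ X' → X' ≤ 3 * x →
      ∑ n ∈ (Icc 1 ⌊X' + y⌋₊).filter (fun n : ℕ => X' < n), (σ 0 n : ℝ) ^ 28 ≤
        C28 * y * (2 * Real.log x) ^ E := by
    intro X' h1 h2
    obtain ⟨hx₀, hy1, hy2, hl0, hl2⟩ := hwin X' h1 h2
    refine (h28 X' y (((le_max_left _ _).trans (le_max_right _ _)).trans hx₀) hy1 hy2).trans ?_
    exact mul_le_mul_of_nonneg_left (hpowE X' _ hE28 hl0 hl2) (by positivity)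
  have hS4 : ∀ X' : ℝ, x / 2 - |(a : ℝ)| ≤ X' → X' ≤ 3 * x →
      ∑ n ∈ (Icc 1 ⌊X' + y⌋₊).filter (fun n : ℕ => X' < n), (σ 0 n : ℝ) ^ 4 ≤
        C4 * y * (2 * Real.log x) ^ E := by
    intro X' h1 h2
    obtain ⟨hx₀, hy1, hy2, hl0, hl2⟩ := hwin X' h1 h2
    refine (h4 X' y (((le_max_right _ _).trans (le_max_right _ _)).trans hx₀) hy1 hy2).trans ?_
    exact mul_le_mul_of_nonneg_left (hpowE X' _ hE4 hl0 hl2) (by positivity)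
  -- the two slivers `(x, x+y]` and `(2x−y, 2x]` and their shifts by `a`
  have hw1 : x / 2 - |(a : ℝ)| ≤ x ∧ x ≤ 3 * x := ⟨by linarith, by linarith⟩
  have hw2 : x / 2 - |(a : ℝ)| ≤ 2 * x - y ∧ 2 * x - y ≤ 3 * x := ⟨by linarith, by linarith⟩
  have haa : (a : ℝ) ≤ |(a : ℝ)| := le_abs_self _
  have haa' : -(a : ℝ) ≤ |(a : ℝ)| := neg_le_abs _
  have hw1' : x / 2 - |(a : ℝ)| ≤ x - a ∧ x - a ≤ 3 * x := ⟨by linarith, by linarith⟩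
  have hw2' : x / 2 - |(a : ℝ)| ≤ 2 * x - y - a ∧ 2 * x - y - a ≤ 3 * x := ⟨by linarith, by linarith⟩
  -- the pointwise majorant
  set G : ℕ → ℝ := fun n => if (n : ℝ) ≤ x + y ∨ 2 * x - y < n then (σ 0 n : ℝ) ^ 14 else 0 with hGdef
  have hG : ∀ n ∈ Ioc ⌊x⌋₊ ⌊2 * x⌋₊,
      ∑ κ ∈ (tuples j K).filter (fun κ => ¬ Interior x Δ j κ), |prodMain x z Δ U j κ n| ≤ G n := by
    intro n hn
    rw [Finset.mem_Ioc] at hn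
    exact sum_abs_prodMain_not_interior_le hj hj7 hx0 hΔ0.le (by linarith) (by omega)
  refine (sum_sum_abs_sievedDisc_le_pairs _ (fun κ n => prodMain x z Δ U j κ n) hxa hG z Qn Rn).trans ?_
  -- membership transfer: `n ∈ (x, 2x]` in a sliver lies in the corresponding Shiu window
  have hmem1 : ∀ n ∈ Ioc ⌊x⌋₊ ⌊2 * x⌋₊, (n : ℝ) ≤ x + y →
      n ∈ (Icc 1 ⌊x + y⌋₊).filter (fun n : ℕ => x < n) := by
    intro n hn h
    rw [Finset.mem_Ioc] at hn
    rw [Finset.mem_filter, Finset.mem_Icc]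
    exact ⟨⟨by omega, Nat.le_floor h⟩, Nat.lt_of_floor_lt hn.1⟩
  have hmem2 : ∀ n ∈ Ioc ⌊x⌋₊ ⌊2 * x⌋₊, 2 * x - y < n →
      n ∈ (Icc 1 ⌊(2 * x - y) + y⌋₊).filter (fun n : ℕ => 2 * x - y < n) := by
    intro n hn h
    rw [Finset.mem_Ioc] at hn
    rw [Finset.mem_filter, Finset.mem_Icc]
    refine ⟨⟨by omega, ?_⟩, h⟩
    rw [show 2 * x - y + y = 2 * x by ring]; exact hn.2
  -- a sum of a nonnegative function over the slivers is bounded by the two window sums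
  have hsplit : ∀ f : ℕ → ℝ, (∀ n, 0 ≤ f n) →
      ∑ n ∈ Ioc ⌊x⌋₊ ⌊2 * x⌋₊, (if (n : ℝ) ≤ x + y ∨ 2 * x - y < n then f n else 0) ≤
        (∑ n ∈ (Icc 1 ⌊x + y⌋₊).filter (fun n : ℕ => x < n), f n) +
          ∑ n ∈ (Icc 1 ⌊(2 * x - y) + y⌋₊).filter (fun n : ℕ => 2 * x - y < n), f n := by
    intro f hf
    calc ∑ n ∈ Ioc ⌊x⌋₊ ⌊2 * x⌋₊, (if (n : ℝ) ≤ x + y ∨ 2 * x - y < n then f n else 0)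
        ≤ ∑ n ∈ Ioc ⌊x⌋₊ ⌊2 * x⌋₊,
            ((if (n : ℝ) ≤ x + y then f n else 0) + (if 2 * x - y < n then f n else 0)) := by
          refine Finset.sum_le_sum fun n _ => ?_
          by_cases ha1 : (n : ℝ) ≤ x + y <;> by_cases ha2 : 2 * x - y < n <;> simp [ha1, ha2, hf n]
      _ = (∑ n ∈ (Ioc ⌊x⌋₊ ⌊2 * x⌋₊).filter (fun n : ℕ => (n : ℝ) ≤ x + y), f n) +
          ∑ n ∈ (Ioc ⌊x⌋₊ ⌊2 * x⌋₊).filter (fun n : ℕ => 2 * x - y < n), f n := by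
          rw [Finset.sum_add_distrib, Finset.sum_filter, Finset.sum_filter]
      _ ≤ _ := by
          refine add_le_add (Finset.sum_le_sum_of_subset_of_nonneg (fun n hn => ?_) fun _ _ _ => hf _)
            (Finset.sum_le_sum_of_subset_of_nonneg (fun n hn => ?_) fun _ _ _ => hf _)
          · rw [Finset.mem_filter] at hn; exact hmem1 n hn.1 hn.2
          · rw [Finset.mem_filter] at hn; exact hmem2 n hn.1 hn.2
  -- (i) the plain sliver mass
  have hI : ∑ n ∈ Ioc ⌊x⌋₊ ⌊2 * x⌋₊, G n ≤ 2 * C14 * y * (2 * Real.log x) ^ E := by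
    refine (hsplit (fun n => (σ 0 n : ℝ) ^ 14) fun n => by positivity).trans ?_
    have h1 := hS14 x hw1.1 hw1.2
    have h2 := hS14 (2 * x - y) hw2.1 hw2.2
    linarith
  -- (ii) the sliver mass against the pair count
  have hII : ∑ n ∈ Ioc ⌊x⌋₊ ⌊2 * x⌋₊, G n * (σ 0 ((n : ℤ) - a).natAbs : ℝ) ^ 2 ≤
      (C28 + C4) * y * (2 * Real.log x) ^ E := by
    have hGτ : ∀ n : ℕ, G n * (σ 0 ((n : ℤ) - a).natAbs : ℝ) ^ 2 ≤
        (if (n : ℝ) ≤ x + y ∨ 2 * x - y < n then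
          ((σ 0 n : ℝ) ^ 28 + (σ 0 ((n : ℤ) - a).natAbs : ℝ) ^ 4) / 2 else 0) := by
      intro n
      simp only [hGdef]
      split_ifs
      · exact pow14_mul_sq_le _ _
      · simp
    refine (Finset.sum_le_sum fun n _ => hGτ n).trans ?_
    refine (hsplit (fun n => ((σ 0 n : ℝ) ^ 28 + (σ 0 ((n : ℤ) - a).natAbs : ℝ) ^ 4) / 2)
      fun n => by positivity).trans ?_
    -- window 1
    have hA1 := hS28 x hw1.1 hw1.2
    have hB1 : ∑ n ∈ (Icc 1 ⌊x + y⌋₊).filter (fun n : ℕ => x < n), (σ 0 ((n : ℤ) - a).natAbs : ℝ) ^ 4 ≤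
        C4 * y * (2 * Real.log x) ^ E :=
      (sum_filter_shift_le hxa (fun m => (σ 0 m : ℝ) ^ 4) fun m => by positivity).trans
        (hS4 (x - a) hw1'.1 hw1'.2)
    -- window 2
    have hA2 := hS28 (2 * x - y) hw2.1 hw2.2
    have hxa2 : |(a : ℝ)| ≤ 2 * x - y := by linarith
    have hB2 : ∑ n ∈ (Icc 1 ⌊(2 * x - y) + y⌋₊).filter (fun n : ℕ => 2 * x - y < n),
        (σ 0 ((n : ℤ) - a).natAbs : ℝ) ^ 4 ≤ C4 * y * (2 * Real.log x) ^ E := by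
      refine (sum_filter_shift_le hxa2 (fun m => (σ 0 m : ℝ) ^ 4) fun m => by positivity).trans ?_
      have := hS4 (2 * x - y - a) hw2'.1 hw2'.2
      rwa [show 2 * x - y - (a : ℝ) = 2 * x - y - a by ring] at this
    have hsum1 : ∑ n ∈ (Icc 1 ⌊x + y⌋₊).filter (fun n : ℕ => x < n),
        ((σ 0 n : ℝ) ^ 28 + (σ 0 ((n : ℤ) - a).natAbs : ℝ) ^ 4) / 2 ≤
        (C28 * y * (2 * Real.log x) ^ E + C4 * y * (2 * Real.log x) ^ E) / 2 := by
      rw [← Finset.sum_div, Finset.sum_add_distrib]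
      exact div_le_div_of_nonneg_right (add_le_add hA1 hB1) (by norm_num)
    have hsum2 : ∑ n ∈ (Icc 1 ⌊(2 * x - y) + y⌋₊).filter (fun n : ℕ => 2 * x - y < n),
        ((σ 0 n : ℝ) ^ 28 + (σ 0 ((n : ℤ) - a).natAbs : ℝ) ^ 4) / 2 ≤
        (C28 * y * (2 * Real.log x) ^ E + C4 * y * (2 * Real.log x) ^ E) / 2 := by
      rw [← Finset.sum_div, Finset.sum_add_distrib]
      exact div_le_div_of_nonneg_right (add_le_add hA2 hB2) (by norm_num)
    linarith
  -- the totient factor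
  have hΦ : ∑ r ∈ Icc 1 Rn, ∑ q ∈ Icc 1 Qn, ((Nat.totient (q * r) : ℝ))⁻¹ ≤ 16 * Real.log x ^ 4 := by
    refine (sum_sum_totient_mul_inv_le Qn Rn).trans ?_
    have hlogQ : Real.log Qn ≤ Real.log x := by
      rcases Nat.eq_zero_or_pos Qn with h0 | hpos
      · rw [h0]; simp [hL0.le]
      · exact Real.log_le_log (by exact_mod_cast hpos) hQn
    have hlogR : Real.log Rn ≤ Real.log x := by
      rcases Nat.eq_zero_or_pos Rn with h0 | hpos
      · rw [h0]; simp [hL0.le]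
      · exact Real.log_le_log (by exact_mod_cast hpos) hRn
    have hlogQ0 : 0 ≤ Real.log Qn := Real.log_natCast_nonneg _
    have hlogR0 : 0 ≤ Real.log Rn := Real.log_natCast_nonneg _
    have h1 : (1 + Real.log Qn) ^ 2 ≤ 4 * Real.log x ^ 2 := by nlinarith
    have h2 : (1 + Real.log Rn) ^ 2 ≤ 4 * Real.log x ^ 2 := by nlinarith
    calc _ ≤ (4 * Real.log x ^ 2) * (4 * Real.log x ^ 2) := mul_le_mul h1 h2 (by positivity) (by positivity)
      _ = 16 * Real.log x ^ 4 := by ring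
  have hI0 : 0 ≤ ∑ n ∈ Ioc ⌊x⌋₊ ⌊2 * x⌋₊, G n := Finset.sum_nonneg fun n _ => by
    simp only [hGdef]; split_ifs <;> positivity
  -- assemble
  have hL4 : (1 : ℝ) ≤ Real.log x ^ 4 := one_le_pow₀ hL1
  calc (∑ n ∈ Ioc ⌊x⌋₊ ⌊2 * x⌋₊, G n * (σ 0 ((n : ℤ) - a).natAbs : ℝ) ^ 2) +
        (∑ r ∈ Icc 1 Rn, ∑ q ∈ Icc 1 Qn, ((Nat.totient (q * r) : ℝ))⁻¹) * ∑ n ∈ Ioc ⌊x⌋₊ ⌊2 * x⌋₊, G n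
      ≤ (C28 + C4) * y * (2 * Real.log x) ^ E + (16 * Real.log x ^ 4) * (2 * C14 * y * (2 * Real.log x) ^ E) :=
        add_le_add hII (mul_le_mul hΦ hI hI0 (by positivity))
    _ ≤ (C28 + C4) * y * (2 * Real.log x) ^ E * Real.log x ^ 4 +
        (16 * Real.log x ^ 4) * (2 * C14 * y * (2 * Real.log x) ^ E) := by
        refine add_le_add ?_ le_rfl
        exact le_mul_of_one_le_right (by positivity) hL4
    _ = 28 * 2 ^ E * (C28 + C4 + 32 * C14) * Δ * x * (Real.log x ^ E * Real.log x ^ 4) := by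
        rw [hy, mul_pow]; ring
    _ = 28 * 2 ^ E * (C28 + C4 + 32 * C14) * Δ * x * Real.log x ^ ((E + 4 : ℕ) : ℝ) := by
        rw [← pow_add, Real.rpow_natCast]


/-! ### The finite-sum skeleton of §15, over a general index set of moduli -/

/-- **The finite-sum skeleton of §15** (abstract, general index set — for Theorem 9 the index is a
pair `(r, q)` of moduli): if `S(q) = ∑_κ (c_κ A_κ(q) + E_κ(q))` with `0 ≤ c_κ ≤ L_c`, `|λ| ≤ 1`, the
"interior" `κ` obey `|∑_q λ(q) A_κ(q)| ≤ B_I`, the others `∑_q ∑_{κ not interior} |A_κ(q)| ≤ B_N`,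
and `∑_q ∑_κ |E_κ(q)| ≤ B_E`, then `|∑_q λ(q) S(q)| ≤ #T · L_c · B_I + L_c · B_N + B_E`.
(`BFI.abstract_piece_sum_bound` verbatim, with `Finset ℕ` replaced by a `Finset` of any type.)
[folklore] -/
theorem abstract_piece_sum_bound' {M K : Type*} (F : Finset M) (T : Finset K) (pI : K → Prop)
    [DecidablePred pI] (lam S : M → ℝ) (A E : K → M → ℝ) (c : K → ℝ) {BI BN BE Lc : ℝ}
    (hlam : ∀ q, |lam q| ≤ 1) (hS : ∀ q ∈ F, S q = ∑ κ ∈ T, (c κ * A κ q + E κ q))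
    (hc0 : ∀ κ ∈ T, 0 ≤ c κ) (hc1 : ∀ κ ∈ T, c κ ≤ Lc) (hLc0 : 0 ≤ Lc)
    (hI : ∀ κ ∈ T, pI κ → |∑ q ∈ F, lam q * A κ q| ≤ BI) (hBI : 0 ≤ BI)
    (hN : ∑ q ∈ F, ∑ κ ∈ T.filter (fun κ => ¬ pI κ), |A κ q| ≤ BN)
    (hE : ∑ q ∈ F, ∑ κ ∈ T, |E κ q| ≤ BE) :
    |∑ q ∈ F, lam q * S q| ≤ T.card * Lc * BI + Lc * BN + BE := by
  -- expand
  have hexp : ∑ q ∈ F, lam q * S q =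
      (∑ κ ∈ T, c κ * ∑ q ∈ F, lam q * A κ q) + ∑ q ∈ F, ∑ κ ∈ T, lam q * E κ q := by
    calc ∑ q ∈ F, lam q * S q = ∑ q ∈ F, ∑ κ ∈ T, (c κ * (lam q * A κ q) + lam q * E κ q) := by
          refine Finset.sum_congr rfl fun q hq => ?_
          rw [hS q hq, Finset.mul_sum]
          exact Finset.sum_congr rfl fun κ _ => by ring
      _ = (∑ q ∈ F, ∑ κ ∈ T, c κ * (lam q * A κ q)) + ∑ q ∈ F, ∑ κ ∈ T, lam q * E κ q := by
          rw [← Finset.sum_add_distrib]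
          exact Finset.sum_congr rfl fun q _ => Finset.sum_add_distrib
      _ = _ := by
          congr 1
          rw [Finset.sum_comm]
          exact Finset.sum_congr rfl fun κ _ => by rw [Finset.mul_sum]
  rw [hexp]
  refine (abs_add_le _ _).trans (add_le_add ?_ ?_)
  · -- the main products
    calc |∑ κ ∈ T, c κ * ∑ q ∈ F, lam q * A κ q|
        ≤ ∑ κ ∈ T, c κ * |∑ q ∈ F, lam q * A κ q| := by
          refine (Finset.abs_sum_le_sum_abs _ _).trans (Finset.sum_le_sum fun κ hκ => ?_)
          rw [abs_mul, abs_of_nonneg (hc0 κ hκ)]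
      _ = (∑ κ ∈ T.filter pI, c κ * |∑ q ∈ F, lam q * A κ q|) +
            ∑ κ ∈ T.filter (fun κ => ¬ pI κ), c κ * |∑ q ∈ F, lam q * A κ q| :=
          (Finset.sum_filter_add_sum_filter_not T pI _).symm
      _ ≤ (∑ κ ∈ T.filter pI, Lc * BI) +
            ∑ κ ∈ T.filter (fun κ => ¬ pI κ), Lc * ∑ q ∈ F, |A κ q| := by
          refine add_le_add (Finset.sum_le_sum fun κ hκ => ?_) (Finset.sum_le_sum fun κ hκ => ?_)
          · rw [Finset.mem_filter] at hκ
            exact mul_le_mul (hc1 κ hκ.1) (hI κ hκ.1 hκ.2) (abs_nonneg _) ((hc0 κ hκ.1).trans (hc1 κ hκ.1))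
          · rw [Finset.mem_filter] at hκ
            refine mul_le_mul (hc1 κ hκ.1) ?_ (abs_nonneg _) ((hc0 κ hκ.1).trans (hc1 κ hκ.1))
            refine (Finset.abs_sum_le_sum_abs _ _).trans (Finset.sum_le_sum fun q _ => ?_)
            rw [abs_mul]
            exact (mul_le_mul_of_nonneg_right (hlam q) (abs_nonneg _)).trans (by rw [one_mul])
      _ ≤ T.card * Lc * BI + Lc * BN := by
          refine add_le_add ?_ ?_
          · rw [Finset.sum_const, nsmul_eq_mul]
            calc ((T.filter pI).card : ℝ) * (Lc * BI) ≤ T.card * (Lc * BI) := by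
                  refine mul_le_mul_of_nonneg_right ?_ (mul_nonneg hLc0 hBI)
                  exact_mod_cast Finset.card_filter_le _ _
              _ = T.card * Lc * BI := by ring
          · rw [← Finset.mul_sum]
            refine mul_le_mul_of_nonneg_left ?_ hLc0
            rw [Finset.sum_comm]; exact hN
  · -- the error products
    calc |∑ q ∈ F, ∑ κ ∈ T, lam q * E κ q| ≤ ∑ q ∈ F, ∑ κ ∈ T, |E κ q| := by
          refine (Finset.abs_sum_le_sum_abs _ _).trans (Finset.sum_le_sum fun q _ => ?_)
          refine (Finset.abs_sum_le_sum_abs _ _).trans (Finset.sum_le_sum fun κ _ => ?_)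
          rw [abs_mul]
          exact (mul_le_mul_of_nonneg_right (hlam q) (abs_nonneg _)).trans (by rw [one_mul])
      _ ≤ BE := hE

/-- The signed pair sum of Theorem 9 as a sum over the product set of pairs (to feed
`abstract_piece_sum_bound'`). [folklore] -/
theorem pairSum_eq_sum_product (SR SQ : Finset ℕ) (δ : ℕ → ℝ) (X : ℕ → ℝ) :
    ∑ r ∈ SR, δ r * ∑ q ∈ SQ, X (q * r) = ∑ p ∈ SR ×ˢ SQ, δ p.1 * X (p.2 * p.1) := by
  rw [Finset.sum_product]
  exact Finset.sum_congr rfl fun r _ => by rw [Finset.mul_sum]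

/-- A double sum of nonnegative terms over the filtered pair ranges is at most the double sum over the
full ranges, written over the product set. [folklore] -/
theorem sum_product_filter_le {SR SQ : Finset ℕ} (pR pQ : ℕ → Prop) [DecidablePred pR]
    [DecidablePred pQ] {f : ℕ × ℕ → ℝ} (hf : ∀ p, 0 ≤ f p) :
    ∑ p ∈ SR.filter pR ×ˢ SQ.filter pQ, f p ≤ ∑ r ∈ SR, ∑ q ∈ SQ, f (r, q) := by
  rw [← Finset.sum_product]
  exact Finset.sum_le_sum_of_subset_of_nonneg
    (Finset.product_subset_product (Finset.filter_subset _ _) (Finset.filter_subset _ _))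
    fun p _ _ => hf p

end BFI

end Literature.NumberTheory.Sieve
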